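import Summits.CriticalPhenomena.Ising3DConformalLimit.Theses.SubPtolemyInterlacing
import Literature.Probability.LatticeModels.CriticalScalingDimension
import Literature.Probability.LatticeModels.CriticalUrsellFourSign

/-!
# Sketch for crux `InterlacingForcesU4` (item stmt-CriticalPhenomena-15704), ideator 2

Idea `dyadic-doubling-balanced`: run the whole argument along the dyadic meshes `δ_k = 2^{-(k+1)}`
at the Ptolemy-balanced configuration `x⋆ = (0,2,3,6)·e₁`, and keep the scaling dimension only
through the doubling ratio `u = 2^{-2Δ}`; the balanced-point sub-Ptolemy inequality is homogeneous
in the two numbers `s₁ = S₂(0,e₁)`, `s₃ = S₂(0,3e₁)`, so `U₄(x⋆) ≤ s₁ s₃ (1 - 2u - u²) < 0` once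
`u > √2 - 1`, i.e. `2Δ ≤ a < log₂(1+√2)`.

Status: COMPLETE candidate proof — `interlacingForcesU4_candidate : InterlacingForcesU4` at the end,
sorry-free, axioms `propext / Classical.choice / Quot.sound` (farm `lean check`, audit class
proof-of-item). First lemma = `limit_subPtolemy_xStar'`; floor step = `two_mul_dim_le_of_axialFloor`;
arithmetic cores `sqrt_two_sub_one_lt_doublingRatio`, `u4_balanced_neg`. A prover may land this file's
content verbatim as `Summits/CriticalPhenomena/Ising3DConformalLimit/Theorems/<Name>.lean`
(planners do not propose to Theorems/).
-/

noncomputable section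

open Filter Topology Literature.Probability.LatticeModels
open Summit.CriticalPhenomena.Ising3DConformalLimit.Theses.SubPtolemyInterlacing

namespace Summit.CriticalPhenomena.Ising3DConformalLimit.Cruxes.InterlacingForcesU4.Sketch

/-- axis point `t e₁ ∈ ℝ³` -/
abbrev axPt (t : ℝ) : EuclideanSpace ℝ (Fin 3) := EuclideanSpace.single 0 t

/-- the Ptolemy-balanced configuration `x⋆ = (0, 2e₁, 3e₁, 6e₁)` -/
def xStar : Fin 4 → EuclideanSpace ℝ (Fin 3) := ![0, axPt 2, axPt 3, axPt 6]

/-- `x⋆` is non-coincident (read the first coordinate). -/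
theorem xStar_mem_nonCoincident : xStar ∈ NonCoincident 3 4 := by
  rw [mem_nonCoincident]
  intro i j hij
  have h := congrArg (fun v : EuclideanSpace ℝ (Fin 3) => v 0) hij
  fin_cases i <;> fin_cases j <;> first | rfl | norm_num [xStar, axPt] at h

/-- The axis site `m e₁ ∈ ℤ³` in the form used by `Interlacing` (`(m:ℤ) • e₁`). -/
abbrev axSite (m : ℕ) : Site 3 := (m : ℤ) • (Pi.single 0 1 : Site 3)

/-- `(m:ℤ) • e₁ = Pi.single 0 m`. -/
theorem axSite_eq (m : ℕ) : axSite m = Pi.single (0 : Fin 3) (m : ℤ) := by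
  funext i
  fin_cases i <;> simp [axSite]

/-- Dyadic exactness at `x⋆`: at mesh `δ_k = 2^{-(k+1)}` the lattice approximants are the axis sites
`0, 2N e₁, 3N e₁, 6N e₁` with `N = 2^{k+1}` — Interlacing's quadruple `(0, a, a+b, a+b+c)` with
`(a, b, c) = (2N, N, 3N)`, no floor error (tree: `latticeApprox_dyadic_unitVec`). -/
theorem latticeApprox_xStar (k : ℕ) :
    (fun i => latticeApprox ((2:ℝ)⁻¹ ^ (k + 1)) (xStar i)) =
      ![axSite 0, axSite (2 * 2 ^ (k + 1)), axSite (3 * 2 ^ (k + 1)), axSite (6 * 2 ^ (k + 1))] := by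
  have h2 := latticeApprox_dyadic_unitVec k 2
  have h3 := latticeApprox_dyadic_unitVec k 3
  have h6 := latticeApprox_dyadic_unitVec k 6
  simp only [axSite_eq]
  push_cast at h2 h3 h6 ⊢
  funext i
  fin_cases i
  · simp [xStar, latticeApprox_zero]
  · simpa [xStar, axPt] using h2
  · simpa [xStar, axPt] using h3
  · simpa [xStar, axPt] using h6

/-- The lattice input, read off `Interlacing` at `(a,b,c) = (2N, N, 3N)`:
with `q m = m e₁ = (m:ℤ) • e₁`. -/
theorem interlacing_balanced (hI : Interlacing) (N : ℕ) (hN : 1 ≤ N) :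
    criticalCorr 3 4 ![axSite 0, axSite (2 * N), axSite (3 * N), axSite (6 * N)] *
        (criticalCorr 3 2 ![axSite 0, axSite (3 * N)] *
          criticalCorr 3 2 ![axSite (2 * N), axSite (6 * N)]) ≤
      criticalCorr 3 2 ![axSite 0, axSite (2 * N)] * criticalCorr 3 2 ![axSite (3 * N), axSite (6 * N)] *
        (criticalCorr 3 2 ![axSite 0, axSite (6 * N)] *
          criticalCorr 3 2 ![axSite (2 * N), axSite (3 * N)]) := by
  have h := hI (2 * N) N (3 * N) (by omega) hN (by omega)
  have e3 : 2 * N + N = 3 * N := by ring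
  have e6 : 2 * N + N + 3 * N = 6 * N := by ring
  simp only at h
  rw [e6, e3] at h
  exact h

/-- **FIRST LEMMA (consumes the lattice inequality, in its weakest EVENTUAL balanced dyadic form:
SPC at `(0, 2N, 3N, 6N)·e₁`, `N = 2^{k+1}`, for all `k ≥ K` — so the proof survives a restatement of
`Interlacing` to its eventual / dyadic-only form).** The sub-Ptolemy inequality passes to the
scaling limit at `x⋆`: multiply the lattice inequality at mesh `δ_k` by `ρ(δ_k)⁸ ≥ 0` (even power — the
sign of `ρ` is irrelevant), recognise seven rescaled correlators at `x⋆` and its ordered sub-pairs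
(`latticeApprox_xStar`, `(m:ℤ) • e₁ = Pi.single 0 m`), and pass to the limit along
`tendsto_dyadicMesh` (eventually in `k`) with `le_of_tendsto_of_tendsto'`, exactly as in the tree's
`tendsto_rescaled_criticalUrsellFour` (`(hlim 4).tendsto_at`, `(hlim 2).tendsto_at` at the six
sub-pairs via `pair_mem_nonCoincident`). No `ρ > 0`, no covariance, no floor, no continuity of `S`. -/
theorem limit_subPtolemy_xStar' {ρ : ℝ → ℝ} {S : CorrFamily 3} (K : ℕ)
    (hK : ∀ k : ℕ, K ≤ k →
      criticalCorr 3 4 ![axSite 0, axSite (2 * 2 ^ (k + 1)), axSite (3 * 2 ^ (k + 1)),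
          axSite (6 * 2 ^ (k + 1))] *
          (criticalCorr 3 2 ![axSite 0, axSite (3 * 2 ^ (k + 1))] *
            criticalCorr 3 2 ![axSite (2 * 2 ^ (k + 1)), axSite (6 * 2 ^ (k + 1))]) ≤
        criticalCorr 3 2 ![axSite 0, axSite (2 * 2 ^ (k + 1))] *
            criticalCorr 3 2 ![axSite (3 * 2 ^ (k + 1)), axSite (6 * 2 ^ (k + 1))] *
          (criticalCorr 3 2 ![axSite 0, axSite (6 * 2 ^ (k + 1))] *
            criticalCorr 3 2 ![axSite (2 * 2 ^ (k + 1)), axSite (3 * 2 ^ (k + 1))]))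
    (hlim : HasPointwiseScalingLimit (criticalCorr 3) ρ S) :
    S 4 xStar * (S 2 ![xStar 0, xStar 2] * S 2 ![xStar 1, xStar 3]) ≤
      S 2 ![xStar 0, xStar 1] * S 2 ![xStar 2, xStar 3] *
        (S 2 ![xStar 0, xStar 3] * S 2 ![xStar 1, xStar 2]) := by
  have hinj : Function.Injective xStar := xStar_mem_nonCoincident
  set δ : ℕ → ℝ := fun k => (2 : ℝ)⁻¹ ^ (k + 1) with hδ
  -- the seven convergent sequences along the dyadic meshes
  have hpair : ∀ i j, i ≠ j → Tendsto
      (fun k : ℕ => ρ (δ k) ^ 2 *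
        criticalCorr 3 2 ![latticeApprox (δ k) (xStar i), latticeApprox (δ k) (xStar j)])
      atTop (𝓝 (S 2 ![xStar i, xStar j])) := by
    intro i j hij
    have hmem : (![xStar i, xStar j] : Fin 2 → EuclideanSpace ℝ (Fin 3)) ∈ NonCoincident 3 2 :=
      pair_mem_nonCoincident fun h => hij (hinj h)
    have h := ((hlim 2).tendsto_at hmem).comp tendsto_dyadicMesh
    refine h.congr fun k => ?_
    simp only [Function.comp_apply, rescaledCorrelator_apply, latticeApprox_comp_two]
    rfl
  have h4 : Tendsto (fun k : ℕ => ρ (δ k) ^ 4 * criticalCorr 3 4 (fun i => latticeApprox (δ k) (xStar i)))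
      atTop (𝓝 (S 4 xStar)) := by
    have h := ((hlim 4).tendsto_at xStar_mem_nonCoincident).comp tendsto_dyadicMesh
    refine h.congr fun k => ?_
    simp only [Function.comp_apply, rescaledCorrelator_apply]
    rfl
  have hL := h4.mul ((hpair 0 2 (by decide)).mul (hpair 1 3 (by decide)))
  have hR := ((hpair 0 1 (by decide)).mul (hpair 2 3 (by decide))).mul
    ((hpair 0 3 (by decide)).mul (hpair 1 2 (by decide)))
  refine le_of_tendsto_of_tendsto hL hR ?_
  filter_upwards [eventually_ge_atTop K] with k hk
  -- at mesh `δ_k` every approximant is an exact axis site (dyadic exactness)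
  have happ : ∀ i, latticeApprox (δ k) (xStar i) =
      (![axSite 0, axSite (2 * 2 ^ (k + 1)), axSite (3 * 2 ^ (k + 1)), axSite (6 * 2 ^ (k + 1))] :
        Fin 4 → Site 3) i := fun i => congrFun (latticeApprox_xStar k) i
  have hlat := hK k hk
  have h8 : 0 ≤ ρ (δ k) ^ 8 := Even.pow_nonneg (by decide) _
  have hmul := mul_le_mul_of_nonneg_left hlat h8
  show ρ (δ k) ^ 4 * criticalCorr 3 4 (fun i => latticeApprox (δ k) (xStar i)) *
      (ρ (δ k) ^ 2 * criticalCorr 3 2 ![latticeApprox (δ k) (xStar 0), latticeApprox (δ k) (xStar 2)] *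
        (ρ (δ k) ^ 2 * criticalCorr 3 2 ![latticeApprox (δ k) (xStar 1), latticeApprox (δ k) (xStar 3)])) ≤
    ρ (δ k) ^ 2 * criticalCorr 3 2 ![latticeApprox (δ k) (xStar 0), latticeApprox (δ k) (xStar 1)] *
      (ρ (δ k) ^ 2 * criticalCorr 3 2 ![latticeApprox (δ k) (xStar 2), latticeApprox (δ k) (xStar 3)]) *
      (ρ (δ k) ^ 2 * criticalCorr 3 2 ![latticeApprox (δ k) (xStar 0), latticeApprox (δ k) (xStar 3)] *
        (ρ (δ k) ^ 2 * criticalCorr 3 2 ![latticeApprox (δ k) (xStar 1), latticeApprox (δ k) (xStar 2)]))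
  rw [latticeApprox_xStar k, happ 0, happ 1, happ 2, happ 3]
  simp only [Matrix.cons_val_zero, Matrix.cons_val_one, Matrix.head_cons, Matrix.cons_val_two,
    Matrix.tail_cons, Matrix.cons_val_three]
  nlinarith [hmul]

/-- The first lemma from the crux's antecedent `Interlacing` itself. -/
theorem limit_subPtolemy_xStar {ρ : ℝ → ℝ} {S : CorrFamily 3} (hI : Interlacing)
    (hlim : HasPointwiseScalingLimit (criticalCorr 3) ρ S) :
    S 4 xStar * (S 2 ![xStar 0, xStar 2] * S 2 ![xStar 1, xStar 3]) ≤
      S 2 ![xStar 0, xStar 1] * S 2 ![xStar 2, xStar 3] *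
        (S 2 ![xStar 0, xStar 3] * S 2 ![xStar 1, xStar 2]) :=
  limit_subPtolemy_xStar' 0 (fun k _ => interlacing_balanced hI (2 ^ (k + 1)) Nat.one_le_two_pow) hlim

/-- Translation bookkeeping on the axis (uses `IsTranslationInvariant` with `v = -s e₁`). -/
theorem S_two_axis_translate {S : CorrFamily 3} (htr : IsTranslationInvariant S) (s t : ℝ) :
    S 2 ![axPt s, axPt t] = S 2 ![0, axPt (t - s)] := by
  have h := htr 2 (-(axPt s)) ![axPt s, axPt t]
  rw [← h]
  congr 1
  funext i
  fin_cases i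
  · simp
  · simp only [Fin.mk_one, Matrix.cons_val_one, Matrix.cons_val_fin_one]
    ext j
    simp [axPt]
    split_ifs <;> ring

/-- Doubling on the axis (uses `IsScaleCovariant` at `c = 2` only). -/
theorem S_two_axis_double {S : CorrFamily 3} {Δ : ℝ} (hsc : IsScaleCovariant Δ S) (t : ℝ) :
    S 2 ![0, axPt (2 * t)] = (2:ℝ) ^ (-(2:ℝ) * Δ) * S 2 ![0, axPt t] := by
  have h := hsc 2 2 (by norm_num) ![0, axPt t]
  have hcfg : (fun i => (2:ℝ) • (![0, axPt t] : Fin 2 → EuclideanSpace ℝ (Fin 3)) i) =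
      ![0, axPt (2 * t)] := by
    funext i
    fin_cases i
    · simp
    · simp only [Fin.mk_one, Matrix.cons_val_one, Matrix.cons_val_fin_one]
      ext j
      simp [axPt]
  rw [hcfg] at h
  rw [h]
  norm_num

/-- **Floor ⇒ `2Δ ≤ a`** (one-sided re-run of the upper half of `scalingDimension_mem_Icc_of_bounds`:
`log ρ(δ_k)²/k → 2Δ log 2` is the tree's `tendsto_log_rho_sq_div`, `ρ(δ_k)² G(2^{k+1}e₁) → s₁ > 0` is
`tendsto_rescaled_dyadic`, and the floor gives `log ρ(δ_k)² ≤ log (2 s₁) - log c + a (k+1) log 2`).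
Alternative: `HasPointwiseScalingLimit.tendsto_log_axis_dyadic` (η exists, = 2Δ-1) vs the floor. -/
theorem two_mul_dim_le_of_axialFloor {ρ : ℝ → ℝ} {Δ : ℝ} {S : CorrFamily 3} {a c : ℝ}
    (hc : 0 < c)
    (hfloor : ∀ n : ℕ, 1 ≤ n → c * (n : ℝ) ^ (-a) ≤
      criticalTwoPoint 3 ((n : ℤ) • (Pi.single 0 1 : Site 3)))
    (hρ : ∀ δ ∈ Set.Ioc (0:ℝ) 1, 0 < ρ δ) (hlim : HasPointwiseScalingLimit (criticalCorr 3) ρ S)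
    (hnd : IsNondegenerateTwoPoint S) (hsc : IsScaleCovariant Δ S) : 2 * Δ ≤ a := by
  -- notation as in `scalingDimension_mem_Icc_of_bounds`
  set δ : ℕ → ℝ := fun k => (2 : ℝ)⁻¹ ^ (k + 1) with hδ
  set G : ℕ → ℝ := fun k =>
    criticalTwoPoint 3 (Pi.single (0 : Fin 3) (((1 : ℕ) : ℤ) * 2 ^ (k + 1))) with hG
  set r : ℕ → ℝ := fun k => ρ (δ k) ^ 2 * G k with hr
  set s₁ := S 2 ![0, EuclideanSpace.single (0 : Fin 3) ((1 : ℕ) : ℝ)] with hs₁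
  have hs₁pos : 0 < s₁ := hnd _ (zero_unitVec_mem_nonCoincident (by norm_num))
  have hρk : ∀ k : ℕ, 0 < ρ (δ k) := fun k => hρ _ ⟨dyadicMesh_pos k, dyadicMesh_le_one k⟩
  -- the floor at `n = 2^{k+1}`: `c (2^{k+1})^{-a} ≤ G k`
  have hsite : ∀ k : ℕ, (((2 ^ (k + 1) : ℕ) : ℤ) • (Pi.single 0 1 : Site 3)) =
      Pi.single (0 : Fin 3) (((1 : ℕ) : ℤ) * 2 ^ (k + 1)) := by
    intro k
    funext i
    fin_cases i <;> simp
  have hlow : ∀ k : ℕ, c * ((2 : ℝ) ^ (k + 1)) ^ (-a) ≤ G k := by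
    intro k
    have h := hfloor (2 ^ (k + 1)) Nat.one_le_two_pow
    rw [hsite k] at h
    push_cast at h
    exact h
  have hGpos : ∀ k, 0 < G k := fun k =>
    lt_of_lt_of_le (mul_pos hc (Real.rpow_pos_of_pos (by positivity) _)) (hlow k)
  -- `r k → s₁ > 0`, hence eventually `r k ≤ 2 s₁`
  have hrlim : Tendsto r atTop (𝓝 s₁) := tendsto_rescaled_dyadic hlim (t := 1) one_ne_zero
  have hr_ev : ∀ᶠ k in atTop, r k ≤ 2 * s₁ :=
    (hrlim.eventually_lt_const (by linarith)).mono fun k hk => hk.le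
  -- the main limit `log ρ(δ_k)² / k → 2Δ log 2` (tree)
  have hmain := tendsto_log_rho_sq_div hlim hsc hnd hρ
  have hlog2 : 0 < Real.log 2 := Real.log_pos (by norm_num)
  have hlogeq : ∀ k, Real.log (ρ (δ k) ^ 2) = Real.log (r k) - Real.log (G k) := by
    intro k
    rw [hr]
    simp only
    rw [Real.log_mul (pow_ne_zero _ (hρk k).ne') (hGpos k).ne']
    ring
  have hpowa : ∀ k : ℕ, Real.log (((2 : ℝ) ^ (k + 1)) ^ (-a)) = -(a * ((k + 1 : ℝ) * Real.log 2)) := by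
    intro k
    rw [Real.log_rpow (by positivity), Real.log_pow]
    push_cast
    ring
  have hUB : ∀ᶠ k : ℕ in atTop,
      Real.log (ρ (δ k) ^ 2) / k ≤
        (Real.log (2 * s₁) - Real.log c + a * ((k + 1 : ℝ) * Real.log 2)) / k := by
    filter_upwards [hr_ev, eventually_gt_atTop 0] with k hrk hk
    have hk' : (0 : ℝ) < k := by exact_mod_cast hk
    rw [div_le_div_iff_of_pos_right hk', hlogeq k]
    have hpw : 0 < ((2 : ℝ) ^ (k + 1)) ^ (-a) := Real.rpow_pos_of_pos (by positivity) _
    have h1 : Real.log c + Real.log (((2 : ℝ) ^ (k + 1)) ^ (-a)) ≤ Real.log (G k) := by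
      rw [← Real.log_mul hc.ne' hpw.ne']
      exact Real.log_le_log (mul_pos hc hpw) (hlow k)
    have hrpos : 0 < r k := mul_pos (pow_pos (hρk k) 2) (hGpos k)
    have h2 : Real.log (r k) ≤ Real.log (2 * s₁) := Real.log_le_log hrpos hrk
    rw [hpowa k] at h1
    linarith
  have hinvk : Tendsto (fun k : ℕ => (k : ℝ)⁻¹) atTop (𝓝 0) :=
    tendsto_inv_atTop_zero.comp tendsto_natCast_atTop_atTop
  have hUBlim : Tendsto (fun k : ℕ =>
      (Real.log (2 * s₁) - Real.log c + a * ((k + 1 : ℝ) * Real.log 2)) / k)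
      atTop (𝓝 (a * Real.log 2)) := by
    have h : ∀ k : ℕ, 0 < k →
        (Real.log (2 * s₁) - Real.log c + a * ((k + 1 : ℝ) * Real.log 2)) / k =
          (Real.log (2 * s₁) - Real.log c + a * Real.log 2) * (k : ℝ)⁻¹ + a * Real.log 2 := by
      intro k hk
      have hk' : (k : ℝ) ≠ 0 := by exact_mod_cast hk.ne'
      field_simp
      ring
    have hl := (hinvk.const_mul (Real.log (2 * s₁) - Real.log c + a * Real.log 2)).add_const
      (a * Real.log 2)
    rw [mul_zero, zero_add] at hl
    refine hl.congr' ?_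
    filter_upwards [eventually_gt_atTop 0] with k hk using (h k hk).symm
  have hle : 2 * Δ * Real.log 2 ≤ a * Real.log 2 := le_of_tendsto_of_tendsto hmain hUBlim hUB
  nlinarith

/-- **Threshold arithmetic (proved).** `2Δ ≤ a < log₂(1+√2)` ⇒ `u = 2^{-2Δ} > √2 - 1`. -/
theorem sqrt_two_sub_one_lt_doublingRatio {a Δ : ℝ} (ha : a < Real.logb 2 (1 + Real.sqrt 2))
    (hΔ : 2 * Δ ≤ a) : Real.sqrt 2 - 1 < (2:ℝ) ^ (-(2:ℝ) * Δ) := by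
  have h1 : (2:ℝ) ^ (-a) ≤ (2:ℝ) ^ (-(2:ℝ) * Δ) :=
    Real.rpow_le_rpow_of_exponent_le one_le_two (by linarith)
  have h2 : (2:ℝ) ^ (-(Real.logb 2 (1 + Real.sqrt 2))) < (2:ℝ) ^ (-a) :=
    Real.rpow_lt_rpow_of_exponent_lt one_lt_two (by linarith)
  have hpos : 0 < 1 + Real.sqrt 2 := by positivity
  have h3 : (2:ℝ) ^ (-(Real.logb 2 (1 + Real.sqrt 2))) = Real.sqrt 2 - 1 := by
    rw [Real.rpow_neg (by norm_num), Real.rpow_logb (by norm_num) (by norm_num) hpos]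
    have hs : Real.sqrt 2 ^ 2 = 2 := Real.sq_sqrt (by norm_num)
    have hkey : (1 + Real.sqrt 2) * (Real.sqrt 2 - 1) = 1 := by nlinarith [hs]
    exact inv_eq_of_mul_eq_one_right hkey
  linarith [h1, h2, h3]

/-- **Algebraic core at the balanced point (proved).** With `s₁ = S₂(0,e₁)`, `s₃ = S₂(0,3e₁)`,
`u = 2^{-2Δ}`: the six pair values at `x⋆` are `S₂(01) = u s₁`, `S₂(23) = s₃`, `S₂(02) = s₃`,
`S₂(13) = u² s₁`, `S₂(03) = u s₃`, `S₂(12) = s₁`; the limit sub-Ptolemy inequality reads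
`S₄ · (s₃ · u² s₁) ≤ (u s₁ · s₃) · (u s₃ · s₁)`, i.e. `S₄ ≤ s₁ s₃`, and the Wick sum is
`s₁ s₃ (2u + u²)`, so `U₄(x⋆) ≤ s₁ s₃ (1 - 2u - u²) < 0` iff `u > √2 - 1`. -/
theorem u4_balanced_neg {S4 s1 s3 u : ℝ} (hs1 : 0 < s1) (hs3 : 0 < s3) (hu0 : 0 < u)
    (hu : Real.sqrt 2 - 1 < u)
    (hspc : S4 * (s3 * (u ^ 2 * s1)) ≤ (u * s1) * s3 * ((u * s3) * s1)) :
    S4 - ((u * s1) * s3 + s3 * (u ^ 2 * s1) + (u * s3) * s1) < 0 := by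
  have hpos : 0 < s3 * (u ^ 2 * s1) := by positivity
  have hS4 : S4 ≤ s1 * s3 := by
    have h' : S4 * (s3 * (u ^ 2 * s1)) ≤ (s1 * s3) * (s3 * (u ^ 2 * s1)) := by nlinarith [hspc]
    exact le_of_mul_le_mul_right h' hpos
  have hs : Real.sqrt 2 ^ 2 = 2 := Real.sq_sqrt (by norm_num)
  have hq : 1 - 2 * u - u ^ 2 < 0 := by nlinarith [hu, hs, Real.sqrt_nonneg 2]
  nlinarith [hS4, hq, mul_pos hs1 hs3, mul_pos (mul_pos hs1 hs3) hu0]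

/-- **The crux, assembled from the pieces above** (candidate proof for the item; the `Theorems/`
landing with registered stubs is the prover's job). Uses: `Interlacing` only at the balanced dyadic
quadruples (`interlacing_balanced`, through the eventual-form first lemma); `IsScaleCovariant` only at `(n,c) = (2,2)`; `IsTranslationInvariant`
only for the axis shifts by `−2e₁`, `−3e₁`; `ρ > 0` only inside `two_mul_dim_le_of_axialFloor`. -/
theorem interlacingForcesU4_candidate : InterlacingForcesU4 := by
  intro hI hF ρ Δ S hρ hlim hnd htr hsc
  obtain ⟨a, c, ha, hc, hfloor⟩ := hF
  -- the doubling ratio `u = 2^{-2Δ}` and its lower bound from the floor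
  set u : ℝ := (2:ℝ) ^ (-(2:ℝ) * Δ) with hu
  have hu0 : 0 < u := Real.rpow_pos_of_pos (by norm_num) _
  have hΔa : 2 * Δ ≤ a := two_mul_dim_le_of_axialFloor hc hfloor hρ hlim hnd hsc
  have huroot : Real.sqrt 2 - 1 < u := sqrt_two_sub_one_lt_doublingRatio ha hΔa
  -- the two positive numbers `s₁ = S₂(0,e₁)`, `s₃ = S₂(0,3e₁)`
  have hs1 : 0 < S 2 ![0, axPt 1] := hnd _ (zero_unitVec_mem_nonCoincident one_ne_zero)
  have hs3 : 0 < S 2 ![0, axPt 3] := hnd _ (zero_unitVec_mem_nonCoincident (by norm_num))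
  -- doubling (scale covariance at `c = 2`) and axis translations
  have hd1 : S 2 ![0, axPt 2] = u * S 2 ![0, axPt 1] := by
    have h := S_two_axis_double hsc 1
    rw [mul_one] at h
    rw [hu]; exact h
  have hd2 : S 2 ![0, axPt 4] = u * S 2 ![0, axPt 2] := by
    have h := S_two_axis_double hsc 2
    rw [show (2:ℝ) * 2 = 4 by norm_num] at h
    rw [hu]; exact h
  have hd3 : S 2 ![0, axPt 6] = u * S 2 ![0, axPt 3] := by
    have h := S_two_axis_double hsc 3
    rw [show (2:ℝ) * 3 = 6 by norm_num] at h
    rw [hu]; exact h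
  have ht26 : S 2 ![axPt 2, axPt 6] = S 2 ![0, axPt 4] := by
    have h := S_two_axis_translate htr 2 6
    rwa [show (6:ℝ) - 2 = 4 by norm_num] at h
  have ht36 : S 2 ![axPt 3, axPt 6] = S 2 ![0, axPt 3] := by
    have h := S_two_axis_translate htr 3 6
    rwa [show (6:ℝ) - 3 = 3 by norm_num] at h
  have ht23 : S 2 ![axPt 2, axPt 3] = S 2 ![0, axPt 1] := by
    have h := S_two_axis_translate htr 2 3
    rwa [show (3:ℝ) - 2 = 1 by norm_num] at h
  -- the coordinates of `x⋆`
  have hx0 : xStar 0 = 0 := rfl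
  have hx1 : xStar 1 = axPt 2 := rfl
  have hx2 : xStar 2 = axPt 3 := rfl
  have hx3 : xStar 3 = axPt 6 := rfl
  -- the six pair values at `x⋆`
  have e01 : S 2 ![xStar 0, xStar 1] = u * S 2 ![0, axPt 1] := by rw [hx0, hx1, hd1]
  have e23 : S 2 ![xStar 2, xStar 3] = S 2 ![0, axPt 3] := by rw [hx2, hx3, ht36]
  have e02 : S 2 ![xStar 0, xStar 2] = S 2 ![0, axPt 3] := by rw [hx0, hx2]
  have e13 : S 2 ![xStar 1, xStar 3] = u ^ 2 * S 2 ![0, axPt 1] := by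
    rw [hx1, hx3, ht26, hd2, hd1]; ring
  have e03 : S 2 ![xStar 0, xStar 3] = u * S 2 ![0, axPt 3] := by rw [hx0, hx3, hd3]
  have e12 : S 2 ![xStar 1, xStar 2] = S 2 ![0, axPt 1] := by rw [hx1, hx2, ht23]
  -- the limit sub-Ptolemy inequality at `x⋆`, in the `(s₁, s₃, u)` bookkeeping
  have hspc := limit_subPtolemy_xStar hI hlim
  rw [e01, e23, e02, e13, e03, e12] at hspc
  -- conclude: `U₄(x⋆) < 0`
  refine ⟨xStar, xStar_mem_nonCoincident, ne_of_lt ?_⟩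
  show S 4 xStar - (S 2 ![xStar 0, xStar 1] * S 2 ![xStar 2, xStar 3] +
      S 2 ![xStar 0, xStar 2] * S 2 ![xStar 1, xStar 3] +
      S 2 ![xStar 0, xStar 3] * S 2 ![xStar 1, xStar 2]) < 0
  rw [e01, e23, e02, e13, e03, e12]
  exact u4_balanced_neg hs1 hs3 hu0 huroot hspc

/-- Shape check: the pieces above are exactly what the crux needs (statement only). -/
example : InterlacingForcesU4 ↔
    (Interlacing → SubPtolemyFloor → ∀ (ρ : ℝ → ℝ) (Δ : ℝ) (S : CorrFamily 3),
      (∀ δ ∈ Set.Ioc (0:ℝ) 1, 0 < ρ δ) → HasPointwiseScalingLimit (criticalCorr 3) ρ S →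
      IsNondegenerateTwoPoint S → IsTranslationInvariant S → IsScaleCovariant Δ S →
      HasNontrivialU4 S) := Iff.rfl

end Summit.CriticalPhenomena.Ising3DConformalLimit.Cruxes.InterlacingForcesU4.Sketch

end
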